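import Summits.PneNP.PneNP.Theorems.KarlinRubinMonotoneSufficesRoomBase

/-!
# Crux `MonotoneSuffices` (stmt-PneNP-18026), the GREEDY general detector — part 10a: parameters (integer side)

With `k = ⌈n^{1/2-δ}⌉`, `L = ⌊log₂ n⌋`, the greedy detector uses `Q = n (L+1)⁴/k² + 1`, `t = ⌊log₂ Q⌋ + 1` levels
(so `n (L+1)⁴ < 2^t k² ≤ 4 n (L+1)⁴`, i.e. `n 2^{-t} ≈ k²/(L+1)⁴`), `M = 4n/k + 1` candidates per level and the
threshold `θ = n/2^t + k/4 + 1`. This file: two more eventual base inequalities (`eventually_kBig4`: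
`640 (L+1)⁴ ≤ k`; `eventually_logSlack'`: `a + b log₂(L+1) ≤ ε log₂ n` for all constants) and the integer facts
(`natFacts4`) consumed by the error and size analysis. Elementary.
-/

set_option linter.dupNamespace false -- `Summit.PneNP.PneNP.…`: summit = sub-problem name (D-0017 single-conjunct layout)

namespace Summit.PneNP.PneNP.Theorems.MonotoneSuffices.Greedy

open Filter Real Finset Asymptotics
open Summit.PneNP.PneNP.Theorems.MonotoneSuffices.Room

/-! ### Eventual base inequalities -/

/-- **Eventually `640 (L+1)⁴ ≤ k`**: `log⁴ n = o(n^{1/2-δ})`. [folklore] -/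
theorem eventually_kBig4 {δ : ℝ} (hδ' : δ < 1 / 2) :
    ∀ᶠ n : ℕ in atTop, 640 * (Nat.log 2 n + 1) ^ 4 ≤ ⌈(n : ℝ) ^ (1 / 2 - δ)⌉₊ := by
  have hr : (0 : ℝ) < (1 / 2 - δ) / 4 := by linarith
  -- `|log x| ≤ (log 2 / 12) x^{(1/2-δ)/4}` eventually
  have h1 : ∀ᶠ x : ℝ in atTop, ‖Real.log x‖ ≤ Real.log 2 / 12 * ‖x ^ ((1 / 2 - δ) / 4)‖ :=
    (isLittleO_log_rpow_atTop hr).bound (by positivity)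
  have h1' := h1.natCast_atTop
  filter_upwards [h1', eventually_ge_atTop 2] with n hlog hn2
  have hn1 : 1 ≤ n := by omega
  have hnpos : (0 : ℝ) < n := by exact_mod_cast (show 0 < n by omega)
  have hl2 : 0 < Real.log 2 := Real.log_pos one_lt_two
  -- `L + 1 ≤ 2 log₂ n = 2 log n / log 2`
  have hL : ((Nat.log 2 n : ℕ) : ℝ) + 1 ≤ 2 * (Real.log n / Real.log 2) := by
    have h : (Nat.log 2 n : ℝ) ≤ Real.logb 2 n := by
      rw [Real.le_logb_iff_rpow_le (by norm_num) hnpos, Real.rpow_natCast]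
      exact_mod_cast Nat.pow_log_le_self 2 (by omega)
    have h1 := one_le_logb hn2
    rw [Real.logb] at h h1
    linarith
  have hlog' : Real.log n ≤ Real.log 2 / 12 * (n : ℝ) ^ ((1 / 2 - δ) / 4) := by
    have := hlog
    rwa [Real.norm_of_nonneg (Real.log_nonneg (by exact_mod_cast hn1)),
      Real.norm_of_nonneg (Real.rpow_nonneg hnpos.le _)] at this
  have hpow4 : ((n : ℝ) ^ ((1 / 2 - δ) / 4)) ^ 4 = (n : ℝ) ^ (1 / 2 - δ) := by
    rw [← Real.rpow_mul_natCast hnpos.le]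
    ring_nf
  -- `(L+1) ≤ 2 log n / log 2 ≤ x^{(1/2-δ)/4} / 6`
  have hL' : ((Nat.log 2 n : ℕ) : ℝ) + 1 ≤ (n : ℝ) ^ ((1 / 2 - δ) / 4) / 6 := by
    have hdiv : Real.log n / Real.log 2 ≤ (n : ℝ) ^ ((1 / 2 - δ) / 4) / 12 := by
      rw [div_le_iff₀ hl2]
      linarith
    linarith
  have hL0 : 0 ≤ ((Nat.log 2 n : ℕ) : ℝ) + 1 := by positivity
  have hL4 : (((Nat.log 2 n : ℕ) : ℝ) + 1) ^ 4 ≤ (n : ℝ) ^ (1 / 2 - δ) / 1296 := by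
    calc (((Nat.log 2 n : ℕ) : ℝ) + 1) ^ 4 ≤ ((n : ℝ) ^ ((1 / 2 - δ) / 4) / 6) ^ 4 := pow_le_pow_left₀ hL0 hL' 4
      _ = (n : ℝ) ^ (1 / 2 - δ) / 1296 := by rw [div_pow, hpow4]; norm_num
  have h : ((640 * (Nat.log 2 n + 1) ^ 4 : ℕ) : ℝ) ≤ (⌈(n : ℝ) ^ (1 / 2 - δ)⌉₊ : ℝ) := by
    push_cast
    have := rpow_le_k δ n
    nlinarith [Real.rpow_nonneg hnpos.le (1 / 2 - δ)]
  exact_mod_cast h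

/-- **Eventually `a + b log₂ (L+1) ≤ ε log₂ n`** for all constants `a`, `b ≥ 0`, `ε > 0`:
`log log n = o(log n)`. [folklore] -/
theorem eventually_logSlack' {a b ε : ℝ} (hb : 0 ≤ b) (hε : 0 < ε) :
    ∀ᶠ n : ℕ in atTop, a + b * Real.logb 2 ((Nat.log 2 n : ℝ) + 1) ≤ ε * Real.logb 2 n := by
  have hl2 : 0 < Real.log 2 := Real.log_pos one_lt_two
  -- in the variable `m = log₂ n → ∞`: `a + b (1 + log₂ m) ≤ ε m` eventually
  have hm : ∀ᶠ m : ℝ in atTop, a + b * (1 + Real.logb 2 m) ≤ ε * m := by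
    have h1 : ∀ᶠ m : ℝ in atTop, ‖Real.log m‖ ≤ ε * Real.log 2 / (2 * (b + 1)) * ‖m‖ :=
      Real.isLittleO_log_id_atTop.bound (by positivity)
    filter_upwards [h1, eventually_ge_atTop (max 1 (2 * (a + b) / ε))] with m hlog hm
    have hm1 : 1 ≤ m := le_of_max_le_left hm
    have hm2 : 2 * (a + b) / ε ≤ m := le_of_max_le_right hm
    rw [Real.norm_of_nonneg (Real.log_nonneg hm1), Real.norm_of_nonneg (by linarith)] at hlog
    have h2 : 2 * (a + b) ≤ ε * m := by rwa [div_le_iff₀' hε] at hm2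
    have hlogb : b * Real.logb 2 m ≤ ε / 2 * m := by
      rw [Real.logb]
      have hb1 : 0 < b + 1 := by linarith
      have : b * (Real.log m / Real.log 2) ≤ (b + 1) * (Real.log m / Real.log 2) :=
        mul_le_mul_of_nonneg_right (by linarith) (div_nonneg (Real.log_nonneg hm1) hl2.le)
      have h3 : (b + 1) * (Real.log m / Real.log 2) ≤ ε / 2 * m := by
        rw [mul_div_assoc', div_le_iff₀ hl2]
        have := mul_le_mul_of_nonneg_left hlog hb1.le
        have heq : (b + 1) * (ε * Real.log 2 / (2 * (b + 1)) * m) = ε / 2 * m * Real.log 2 := by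
          field_simp
        linarith [heq]
      linarith
    nlinarith
  have hT : Tendsto (fun n : ℕ => Real.logb 2 (n : ℝ)) atTop atTop :=
    (Real.tendsto_logb_atTop one_lt_two).comp tendsto_natCast_atTop_atTop
  filter_upwards [hT.eventually hm, eventually_ge_atTop 2] with n hn hn2
  have h1 := one_le_logb hn2
  have hnpos : (0 : ℝ) < n := by exact_mod_cast (show 0 < n by omega)
  have hnat : (Nat.log 2 n : ℝ) ≤ Real.logb 2 n := by
    rw [Real.le_logb_iff_rpow_le (by norm_num) hnpos, Real.rpow_natCast]
    exact_mod_cast Nat.pow_log_le_self 2 (by omega)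
  have hL : (Nat.log 2 n : ℝ) + 1 ≤ 2 * Real.logb 2 n := by linarith
  have hL0 : (0 : ℝ) < (Nat.log 2 n : ℝ) + 1 := by positivity
  have hlogL : Real.logb 2 ((Nat.log 2 n : ℝ) + 1) ≤ 1 + Real.logb 2 (Real.logb 2 n) := by
    calc Real.logb 2 ((Nat.log 2 n : ℝ) + 1) ≤ Real.logb 2 (2 * Real.logb 2 n) :=
          Real.logb_le_logb_of_le one_lt_two hL0 hL
      _ = 1 + Real.logb 2 (Real.logb 2 n) := by
          rw [Real.logb_mul (by norm_num) (by linarith), Real.logb_self_eq_one one_lt_two]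
  have h' : a + b * (1 + Real.logb 2 (Real.logb 2 (n : ℝ))) ≤ ε * Real.logb 2 (n : ℝ) := hn
  nlinarith [mul_le_mul_of_nonneg_left hlogL hb]

/-! ### Integer bookkeeping for `Q`, `t`, `M`, `k` -/

/-- **The integer facts of the greedy detector.** [folklore] -/
theorem natFacts4 {n k L Q t M : ℕ} (hL : L = Nat.log 2 n) (hQ : Q = n * (L + 1) ^ 4 / k ^ 2 + 1)
    (ht : t = Nat.log 2 Q + 1) (hM : M = 4 * n / k + 1) (hn : 2048 ≤ n) (hkBig : 640 * (L + 1) ^ 4 ≤ k)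
    (h6k : 6 * k ≤ n) (hk2 : k ^ 2 ≤ 4 * n) :
    Q < 2 ^ t ∧ 2 ^ t ≤ 2 * Q ∧ Q * k ^ 2 ≤ n * (L + 1) ^ 4 + k ^ 2 ∧ n * (L + 1) ^ 4 < Q * k ^ 2 ∧
      1 ≤ t ∧ t ≤ 5 * L + 21 ∧ 160 * t ≤ k ∧ 4 * n < k * M ∧ M ≤ n ∧ 2 * (t * M) + 2 * k ≤ n ∧
      2 ^ t * k ≤ 4 * n ∧ 2 ^ L ≤ n ∧ n < 2 ^ (L + 1) ∧ 11 ≤ L ∧ 80 * t + 64 ≤ (L + 1) ^ 4 := by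
  have hn0 : n ≠ 0 := by omega
  have hL1 : 1 ≤ (L + 1) ^ 4 := Nat.one_le_pow _ _ (by omega)
  have hk0 : 0 < k := by
    have : 640 ≤ 640 * (L + 1) ^ 4 := Nat.le_mul_of_pos_right _ (by positivity)
    omega
  have hk20 : 0 < k ^ 2 := by positivity
  have hQ0 : Q ≠ 0 := by rw [hQ]; exact Nat.succ_ne_zero _
  -- `Q < 2^t ≤ 2Q`
  have h1 : Q < 2 ^ t := by rw [ht]; exact Nat.lt_pow_succ_log_self (by norm_num) Q
  have h2 : 2 ^ t ≤ 2 * Q := by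
    rw [ht, pow_succ]
    have := Nat.pow_log_le_self 2 hQ0
    omega
  have h3 : Q * k ^ 2 ≤ n * (L + 1) ^ 4 + k ^ 2 := by
    rw [hQ, add_mul, one_mul]
    exact Nat.add_le_add_right (Nat.div_mul_le_self _ _) _
  have h4 : n * (L + 1) ^ 4 < Q * k ^ 2 := by
    rw [hQ, add_mul, one_mul]
    exact Nat.lt_div_mul_add hk20
  -- `2^L ≤ n < 2^{L+1}`, `11 ≤ L`
  have hLn : 2 ^ L ≤ n := by rw [hL]; exact Nat.pow_log_le_self 2 hn0
  have hnL : n < 2 ^ (L + 1) := by rw [hL]; exact Nat.lt_pow_succ_log_self (by norm_num) n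
  have hL11 : 11 ≤ L := by
    rw [hL]
    exact Nat.le_log_of_pow_le (by norm_num) (by norm_num; omega)
  -- `1 ≤ t ≤ 5L + 21`
  have h5 : 1 ≤ t := by rw [ht]; omega
  have h6 : t ≤ 5 * L + 21 := by
    have hL1' : L + 1 ≤ 2 ^ L := Nat.lt_two_pow_self
    have hL4 : (L + 1) ^ 4 ≤ n ^ 4 := Nat.pow_le_pow_left (hL1'.trans hLn) 4
    have hQ' : Q ≤ n * (L + 1) ^ 4 + 1 := by rw [hQ]; exact Nat.add_le_add_right (Nat.div_le_self _ _) _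
    have hn5 : 1 ≤ n ^ 5 := Nat.one_le_pow _ _ (Nat.pos_of_ne_zero hn0)
    have hE : n ^ 5 ≤ (2 ^ (L + 1)) ^ 5 := Nat.pow_le_pow_left hnL.le 5
    have hlt : 2 ^ t < 2 ^ (5 * L + 22) := by
      calc 2 ^ t ≤ 2 * Q := h2
        _ ≤ 2 * (n * (L + 1) ^ 4 + 1) := Nat.mul_le_mul_left 2 hQ'
        _ ≤ 2 * (n * n ^ 4 + 1) := by
            have := Nat.mul_le_mul_left n hL4; omega
        _ = 2 * n ^ 5 + 2 := by ring
        _ < 2 ^ 17 * n ^ 5 := by omega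
        _ ≤ 2 ^ 17 * (2 ^ (L + 1)) ^ 5 := Nat.mul_le_mul_left _ hE
        _ = 2 ^ (5 * L + 22) := by rw [← pow_mul, ← pow_add]; ring_nf
    have := (Nat.pow_lt_pow_iff_right (by norm_num)).1 hlt
    omega
  -- `160 t ≤ k`, `80 t + 64 ≤ (L+1)^4`
  have hL4lin : 1728 * (L + 1) ≤ (L + 1) ^ 4 := by
    have h12 : 12 ≤ L + 1 := by omega
    calc 1728 * (L + 1) = 12 ^ 3 * (L + 1) := by norm_num
      _ ≤ (L + 1) ^ 3 * (L + 1) := Nat.mul_le_mul_right _ (Nat.pow_le_pow_left h12 3)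
      _ = (L + 1) ^ 4 := by ring
  have hpoly : 80 * (5 * L + 21) + 64 ≤ (L + 1) ^ 4 := by omega
  have h15 : 80 * t + 64 ≤ (L + 1) ^ 4 := le_trans (by omega) hpoly
  have h7 : 160 * t ≤ k := by
    have : 160 * (5 * L + 21) ≤ 640 * (L + 1) ^ 4 := by omega
    omega
  -- `4n < kM`, `M ≤ n`
  have h8 : 4 * n < k * M := by
    rw [hM, mul_add, mul_one, mul_comm k (4 * n / k)]
    exact Nat.lt_div_mul_add hk0
  have h9 : M ≤ n := by
    rw [hM]
    have hk8 : 8 ≤ k := le_trans (by omega) h7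
    have : 4 * n / k ≤ 4 * n / 8 := Nat.div_le_div_left hk8 (by norm_num)
    omega
  -- `2 tM + 2k ≤ n`: `tM ≤ t (4n/k + 1)`, and `k t (4n/k+1) ≤ 4 t n + t k`
  have h10 : 2 * (t * M) + 2 * k ≤ n := by
    have hMk : M * k ≤ 4 * n + k := by
      rw [hM, add_mul, one_mul]
      exact Nat.add_le_add_right (Nat.div_mul_le_self _ _) _
    -- multiply the goal by `k`
    refine Nat.le_of_mul_le_mul_right ?_ hk0
    have hA : (2 * (t * M) + 2 * k) * k = 2 * t * (M * k) + 2 * k * k := by ring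
    rw [hA]
    have hB : 2 * t * (M * k) ≤ 2 * t * (4 * n + k) := Nat.mul_le_mul_left _ hMk
    have hk2' : k * k ≤ 4 * n := by rw [← sq]; exact hk2
    -- `8 t n + 2 t k + 8 n ≤ n k` since `k ≥ 160 t ≥ 16 t + 16` ... use `k ≥ 160 t` and `t ≥ 1`
    have hC : 2 * t * (4 * n + k) + 2 * k * k ≤ n * k := by
      have e1 : 160 * t * n ≤ k * n := Nat.mul_le_mul_right n h7
      have e2 : 160 * t * k ≤ 4 * n := (Nat.mul_le_mul_right k h7).trans hk2'
      have e4 : 9 * n ≤ k * n := Nat.mul_le_mul_right n (le_trans (by omega) h7)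
      nlinarith [e1, e2, hk2', e4]
    calc 2 * t * (M * k) + 2 * k * k ≤ 2 * t * (4 * n + k) + 2 * k * k := by omega
      _ ≤ n * k := hC
  -- `2^t k ≤ 4n`: `2^t k² ≤ 2 (n (L+1)^4 + k²)` and `k ≥ (L+1)^4`, `2k ≤ n`
  have h11 : 2 ^ t * k ≤ 4 * n := by
    refine Nat.le_of_mul_le_mul_right ?_ hk0
    have hA : 2 ^ t * k * k = 2 ^ t * k ^ 2 := by ring
    rw [hA]
    have hLk : (L + 1) ^ 4 ≤ k := le_trans (by nlinarith) hkBig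
    calc 2 ^ t * k ^ 2 ≤ 2 * Q * k ^ 2 := Nat.mul_le_mul_right _ h2
      _ = 2 * (Q * k ^ 2) := by ring
      _ ≤ 2 * (n * (L + 1) ^ 4 + k ^ 2) := Nat.mul_le_mul_left _ h3
      _ ≤ 2 * (n * k + k ^ 2) := by
          have := Nat.mul_le_mul_left n hLk; omega
      _ ≤ 4 * n * k := by
          have hkn : k ≤ n := by omega
          have e : k ^ 2 ≤ n * k := by rw [sq]; exact Nat.mul_le_mul_right k hkn
          nlinarith [e]
  exact ⟨h1, h2, h3, h4, h5, h6, h7, h8, h9, h10, h11, hLn, hnL, hL11, h15⟩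

end Summit.PneNP.PneNP.Theorems.MonotoneSuffices.Greedy

namespace Summit.PneNP.PneNP.Theorems.MonotoneSuffices.Greedy

/-- Registered sub-goal `greedy_paramsA` of stmt-PneNP-18026 (greedy detector, part 10a): eventually
`640 (L+1)⁴ ≤ k`, exported verbatim. [folklore] -/
theorem greedy_paramsA :
    ∀ {δ : ℝ}, δ < 1 / 2 → ∀ᶠ n : ℕ in Filter.atTop, 640 * (Nat.log 2 n + 1) ^ 4 ≤ ⌈(n : ℝ) ^ (1 / 2 - δ)⌉₊ :=
  fun hδ' => eventually_kBig4 hδ'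

end Summit.PneNP.PneNP.Theorems.MonotoneSuffices.Greedy
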